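import Mathlib

/-!
# Kleitman's diameter bound in `Q₄`

A set of binary strings of length 4 with pairwise Hamming distance `≤ 2` has at most five elements
(piece (K) of the 8-point code bound `CodeBound8`, `HOME/proofs/P4-seven.md` §9.1: the type-`A`
bipartitions orthogonal to an orthogonal pair of the other two types are read as strings of quadrant
choices, and same-type representatives meet in `2` or `3` quadrants, i.e. are at distance `≤ 2`).

Strings are numbers below 16, the distance is the 4-bit popcount of the XOR. Proof: translate by one
member (XOR preserves distances) so that `0` belongs to the set; the other members then have weight
`≤ 2`, and among the ten nonzero strings of weight `≤ 2` any five contain two at distance `≥ 3`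
(`five_low_weight_core`, a 252-case kernel computation on `List.sublistsLen`).
-/

namespace PercRepro

/-- 4-bit popcount. -/
def pop4 (n : ℕ) : ℕ := (n &&& 1) + ((n >>> 1) &&& 1) + ((n >>> 2) &&& 1) + ((n >>> 3) &&& 1)

/-- Hamming distance of two 4-bit strings given as numbers below 16. -/
def hdist4 (a b : ℕ) : ℕ := pop4 (a ^^^ b)

/-- The ten nonzero strings of weight `≤ 2`, sorted. -/
def lowWeight : List ℕ := [1, 2, 3, 4, 5, 6, 8, 9, 10, 12]

set_option maxRecDepth 20000 in
/-- Among any five nonzero strings of weight `≤ 2` two are at distance `≥ 3` (252 cases). -/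
theorem five_low_weight_core :
    (lowWeight.sublistsLen 5).all
      (fun U => U.any fun a => U.any fun b => decide (3 ≤ hdist4 a b)) = true := by
  decide +kernel

/-- The list of low-weight strings is sorted. -/
theorem lowWeight_sortedLE : lowWeight.SortedLE := by
  rw [List.sortedLE_iff_pairwise]; decide

/-- A nonzero string of weight `≤ 2` is one of the ten. -/
theorem mem_lowWeight_of {x : ℕ} (hx : x < 16) (hw : pop4 x ≤ 2) (h0 : x ≠ 0) : x ∈ lowWeight := by
  interval_cases x <;> simp_all [pop4, lowWeight]

/-- Any five nonzero strings of weight `≤ 2` contain two at distance `≥ 3`. -/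
theorem five_low_weight (U : Finset ℕ) (hU : ∀ x ∈ U, x < 16 ∧ pop4 x ≤ 2 ∧ x ≠ 0)
    (h5 : U.card = 5) : ∃ a ∈ U, ∃ b ∈ U, 3 ≤ hdist4 a b := by
  have hsub : List.Sublist U.sort lowWeight := by
    apply List.sublist_of_subperm_of_sortedLE
    · apply List.Nodup.subperm (Finset.sort_nodup _ _)
      intro x hx
      rw [Finset.mem_sort _] at hx
      obtain ⟨h1, h2, h3⟩ := hU x hx
      exact mem_lowWeight_of h1 h2 h3
    · exact (Finset.sortedLT_sort U).sortedLE
    · exact lowWeight_sortedLE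
  have hmem : U.sort ∈ lowWeight.sublistsLen 5 :=
    List.mem_sublistsLen.2 ⟨hsub, by rw [Finset.length_sort, h5]⟩
  have hcore := five_low_weight_core
  rw [List.all_eq_true] at hcore
  have h1 := hcore _ hmem
  rw [List.any_eq_true] at h1
  obtain ⟨a, ha, h2⟩ := h1
  rw [List.any_eq_true] at h2
  obtain ⟨b, hb, h3⟩ := h2
  exact ⟨a, (Finset.mem_sort _).1 ha, b, (Finset.mem_sort _).1 hb, of_decide_eq_true h3⟩

/-- Translating both arguments by the same string does not change their XOR. -/
theorem xor_xor_cancel_right (a b s : ℕ) : (a ^^^ s) ^^^ (b ^^^ s) = a ^^^ b := by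
  rw [Nat.xor_assoc, Nat.xor_comm b s, ← Nat.xor_assoc s s b, Nat.xor_self, Nat.zero_xor]

/-- The Hamming distance is invariant under a common XOR translation. -/
theorem hdist4_xor (a b s : ℕ) : hdist4 (a ^^^ s) (b ^^^ s) = hdist4 a b := by
  unfold hdist4; rw [xor_xor_cancel_right]

/-- **Kleitman in `Q₄`**: a set of strings below 16 with pairwise distance `≤ 2` has at most five
elements. -/
theorem kleitman_q4 (S : Finset ℕ) (hS : ∀ a ∈ S, a < 16)
    (h : ∀ a ∈ S, ∀ b ∈ S, hdist4 a b ≤ 2) : S.card ≤ 5 := by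
  classical
  by_contra hlt
  have h6 : 6 ≤ S.card := by omega
  obtain ⟨s, hs⟩ : S.Nonempty := Finset.card_pos.1 (by omega)
  set T : Finset ℕ := (S.erase s).image (fun a => a ^^^ s) with hT
  have hinj : Function.Injective (fun a : ℕ => a ^^^ s) := by
    intro a b hab
    have := congrArg (fun x => x ^^^ s) hab
    simpa [Nat.xor_assoc, Nat.xor_self] using this
  have hTcard : T.card = S.card - 1 := by
    rw [hT, Finset.card_image_of_injective _ hinj, Finset.card_erase_of_mem hs]
  obtain ⟨U, hUT, hU5⟩ : ∃ U ⊆ T, U.card = 5 := Finset.exists_subset_card_eq (by omega)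
  have hUlow : ∀ x ∈ U, x < 16 ∧ pop4 x ≤ 2 ∧ x ≠ 0 := by
    intro x hx
    have hxT := hUT hx
    rw [hT, Finset.mem_image] at hxT
    obtain ⟨b, hb, rfl⟩ := hxT
    rw [Finset.mem_erase] at hb
    refine ⟨?_, ?_, ?_⟩
    · exact Nat.xor_lt_two_pow (n := 4) (hS b hb.2) (hS s hs)
    · exact h b hb.2 s hs
    · intro h0
      apply hb.1
      have := congrArg (fun x => x ^^^ s) h0
      simpa [Nat.xor_assoc, Nat.xor_self] using this
  obtain ⟨a, ha, b, hb, hab⟩ := five_low_weight U hUlow hU5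
  have haT := hUT ha
  have hbT := hUT hb
  rw [hT, Finset.mem_image] at haT hbT
  obtain ⟨a', ha', rfl⟩ := haT
  obtain ⟨b', hb', rfl⟩ := hbT
  rw [hdist4_xor] at hab
  have := h a' (Finset.mem_of_mem_erase ha') b' (Finset.mem_of_mem_erase hb')
  omega

/-! ### The choice-function form -/

/-- A choice function on four quadrants, as a string. -/
def string4 (f : Fin 4 → Bool) : ℕ :=
  (if f 0 then 1 else 0) + (if f 1 then 2 else 0) + (if f 2 then 4 else 0) + (if f 3 then 8 else 0)

/-- Every choice string encodes to a number below `16`. -/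
theorem string4_lt : ∀ f : Fin 4 → Bool, string4 f < 16 := by decide

/-- The Hamming distance of two strings counts the disagreeing quadrants. -/
theorem hdist4_string4 : ∀ f g : Fin 4 → Bool,
    hdist4 (string4 f) (string4 g) = (Finset.univ.filter fun ℓ => f ℓ ≠ g ℓ).card := by
  decide +kernel

/-- The encoding of choice strings as numbers is injective. -/
theorem string4_injective : Function.Injective string4 := by
  intro f g h
  have key : ∀ f g : Fin 4 → Bool, string4 f = string4 g → f = g := by decide
  exact key f g h

/-- **Kleitman in `Q₄`, choice-function form**: a family of choice functions on four quadrants with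
pairwise at most two disagreements has at most five members. -/
theorem kleitman_fun (S : Finset (Fin 4 → Bool))
    (h : ∀ f ∈ S, ∀ g ∈ S, (Finset.univ.filter fun ℓ => f ℓ ≠ g ℓ).card ≤ 2) : S.card ≤ 5 := by
  classical
  have := kleitman_q4 (S.image string4) ?_ ?_
  · rwa [Finset.card_image_of_injective _ string4_injective] at this
  · intro a ha
    rw [Finset.mem_image] at ha
    obtain ⟨f, -, rfl⟩ := ha
    exact string4_lt f
  · intro a ha b hb
    rw [Finset.mem_image] at ha hb
    obtain ⟨f, hf, rfl⟩ := ha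
    obtain ⟨g, hg, rfl⟩ := hb
    rw [hdist4_string4]
    exact h f hf g hg

end PercRepro
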